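import Literature.MathematicalPhysics.QuantumLattice.SchwingerOSAxioms

/-!
# AtomicCalibrationR (stmt-QuantumFields-28169), E2 `stub_offDiagonalWhitney` — Schwartz decay on balls and coordinate separation
# (Plan A steps 4 and 6 of planner ym-idea-11 g15's `STUB-PLAN-offDiagonalWhitney.md`; prover w4 g22, free hands)

Two small bookkeeping facts for the `WhitneyPkg` clauses (iv) and (vi):

* `norm_iteratedFDeriv_le_schwartzNorm_div` — pointwise decay of the derivatives of a Schwartz function in terms of the tree's
  `schwartzNorm`: `‖D^K F(w)‖ ≤ 2^M · schwartzNorm M F / (1 + ‖w‖)^k`, `M = max k K` (Mathlib's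
  `SchwartzMap.one_add_le_sup_seminorm_apply`); `norm_iteratedFDeriv_le_schwartzNorm_div_of_mem_closedBall` — the same on a ball
  `closedBall z R`, `R < 1 + ‖z‖`, with `(1 + ‖z‖ − R)^k` (this is the `B` to feed `AtomicCalibrationRLocalFlatness`);
* `exists_coord_half_norm_le_abs` — a vector of `ℝ⁴` has a coordinate of modulus `≥ ‖v‖/2`; `exists_coord_sep` — if every slot of
  `z` is within `ρ` of the slot of `c` and two slots of `z` are `≥ d` apart, some coordinate of `c_l − c_{l'}` has modulus
  `≥ (d − 2ρ)/2` (clause (iv): `Λ ρ_j ≤ |cp j l k − cp j l' k|`).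

No stub/crux/rung/summit is closed; nothing here touches Yang–Mills; the YM mass gap is NOT proved. [folklore]
-/

set_option autoImplicit false

noncomputable section

open scoped BigOperators ContDiff
open Set Metric
open Literature.MathematicalPhysics.QuantumLattice (schwartzNorm schwartzNorm_nonneg)

namespace Summit.QuantumFields.YangMills.Cruxes.AtomicCalibrationR.WhitneyBookkeeping

/-! ## Schwartz decay in terms of `schwartzNorm` -/

section Decay

variable {X : Type*} [NormedAddCommGroup X] [NormedSpace ℝ X]

/-- **Pointwise decay of derivatives**: `‖D^K F(w)‖ ≤ 2^M schwartzNorm M F / (1 + ‖w‖)^k`, `M = max k K`. [folklore] -/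
theorem norm_iteratedFDeriv_le_schwartzNorm_div (F : SchwartzMap X ℂ) (k K : ℕ) (w : X) :
    ‖iteratedFDeriv ℝ K F w‖ ≤ 2 ^ max k K * schwartzNorm (max k K) F / (1 + ‖w‖) ^ k := by
  have h := SchwartzMap.one_add_le_sup_seminorm_apply (𝕜 := ℂ) (m := (max k K, max k K)) (k := k) (n := K)
    (le_max_left k K) (le_max_right k K) F w
  have hS : (Finset.Iic (max k K, max k K)).sup (fun m => SchwartzMap.seminorm ℂ m.1 m.2) F = schwartzNorm (max k K) F := rfl
  rw [hS] at h
  have hpos : 0 < (1 + ‖w‖) ^ k := by positivity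
  rw [le_div_iff₀ hpos, mul_comm]
  exact h

/-- **Decay on a ball**: for `w ∈ closedBall z R` with `R < 1 + ‖z‖`,
`‖D^K F(w)‖ ≤ 2^M schwartzNorm M F / (1 + ‖z‖ − R)^k`. -/
theorem norm_iteratedFDeriv_le_schwartzNorm_div_of_mem_closedBall (F : SchwartzMap X ℂ) (k K : ℕ) {z w : X} {R : ℝ}
    (hw : w ∈ closedBall z R) (hR : R < 1 + ‖z‖) :
    ‖iteratedFDeriv ℝ K F w‖ ≤ 2 ^ max k K * schwartzNorm (max k K) F / (1 + ‖z‖ - R) ^ k := by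
  refine (norm_iteratedFDeriv_le_schwartzNorm_div F k K w).trans ?_
  have hnum : 0 ≤ 2 ^ max k K * schwartzNorm (max k K) F := by
    have := schwartzNorm_nonneg (max k K) F; positivity
  have hzw : 1 + ‖z‖ - R ≤ 1 + ‖w‖ := by
    rw [mem_closedBall, dist_eq_norm] at hw
    have h1 : ‖z‖ - ‖w‖ ≤ ‖z - w‖ := norm_sub_norm_le z w
    rw [norm_sub_rev] at h1
    linarith
  have hposR : 0 < 1 + ‖z‖ - R := by linarith
  exact div_le_div_of_nonneg_left hnum (pow_pos hposR k) (pow_le_pow_left₀ hposR.le hzw k)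

end Decay

/-! ## Coordinate separation in `ℝ⁴` -/

/-- Some coordinate carries half the Euclidean norm: `∃ i, ‖v‖/2 ≤ |v_i|`. -/
theorem exists_coord_half_norm_le_abs (v : EuclideanSpace ℝ (Fin 4)) : ∃ i : Fin 4, ‖v‖ / 2 ≤ |v i| := by
  obtain ⟨i₀, -, hi₀⟩ := Finset.exists_max_image (Finset.univ : Finset (Fin 4)) (fun i => |v i|) ⟨0, Finset.mem_univ _⟩
  refine ⟨i₀, ?_⟩
  have h0 : 0 ≤ |v i₀| := abs_nonneg _
  have hsum : ∑ i : Fin 4, ‖v i‖ ^ 2 ≤ (2 * |v i₀|) ^ 2 := by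
    calc ∑ i : Fin 4, ‖v i‖ ^ 2 ≤ ∑ _i : Fin 4, |v i₀| ^ 2 :=
          Finset.sum_le_sum fun i _ => by
            rw [Real.norm_eq_abs]; exact pow_le_pow_left₀ (abs_nonneg _) (hi₀ i (Finset.mem_univ _)) 2
      _ = (2 * |v i₀|) ^ 2 := by rw [Finset.sum_const, Finset.card_univ, Fintype.card_fin]; ring
  have hnorm : ‖v‖ ≤ 2 * |v i₀| := by
    rw [EuclideanSpace.norm_eq]
    calc Real.sqrt (∑ i : Fin 4, ‖v i‖ ^ 2) ≤ Real.sqrt ((2 * |v i₀|) ^ 2) := Real.sqrt_le_sqrt hsum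
      _ = 2 * |v i₀| := Real.sqrt_sq (by positivity)
  linarith

/-- **Clause (iv) geometry.**  If every slot of `z` is within `ρ` of the corresponding slot of `c` and the slots `l, l'` of `z` are
`≥ d` apart, then some coordinate of `c_l − c_{l'}` has modulus `≥ (d − 2ρ)/2`. -/
theorem exists_coord_sep {n : ℕ} (z c : Fin n → EuclideanSpace ℝ (Fin 4)) {ρ d : ℝ} (hz : ∀ l, ‖z l - c l‖ ≤ ρ)
    {l l' : Fin n} (hd : d ≤ ‖z l - z l'‖) : ∃ i : Fin 4, (d - 2 * ρ) / 2 ≤ |c l i - c l' i| := by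
  obtain ⟨i, hi⟩ := exists_coord_half_norm_le_abs (c l - c l')
  refine ⟨i, ?_⟩
  have hcc : d - 2 * ρ ≤ ‖c l - c l'‖ := by
    have h1 : ‖z l - z l'‖ ≤ ‖z l - c l‖ + ‖c l - c l'‖ + ‖c l' - z l'‖ := by
      calc ‖z l - z l'‖ = ‖(z l - c l) + (c l - c l') + (c l' - z l')‖ := by congr 1; abel
        _ ≤ ‖(z l - c l) + (c l - c l')‖ + ‖c l' - z l'‖ := norm_add_le _ _
        _ ≤ ‖z l - c l‖ + ‖c l - c l'‖ + ‖c l' - z l'‖ := by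
            have := norm_add_le (z l - c l) (c l - c l'); linarith
    have h2 := hz l
    have h3 : ‖c l' - z l'‖ ≤ ρ := by rw [norm_sub_rev]; exact hz l'
    linarith
  have : (c l - c l') i = c l i - c l' i := rfl
  rw [this] at hi
  linarith

end Summit.QuantumFields.YangMills.Cruxes.AtomicCalibrationR.WhitneyBookkeeping

end
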